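import Summits.ABC.IUTFork.Joshi.ATS4MainBoundsGenuineTheta
import Literature.IUT.LogVolume.DistinguishedPrimesBoundTower
import Literature.IUT.LogVolume.ThetaTowerUnramified
import HarnessLib

/-!
# Joshi, *Arithmetic Teichmüller Spaces IV* (arXiv:2403.10430v2) (6.8.11) «log(s_ℚ) ≤ 2·d_mod·(log(d_{L_tpd}) + log(f_{L_tpd}))
# + log(2·3·5·ℓ)» DERIVED at genuine distinguished primes — R-J census row Y-21f (proof-only supplier file, 0 defs)

Proof-only companion of the abc-iut cell, branch E / D-0079 sub-cell R-J «Joshi Y-discharge census» (rung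
LADDER-ABC:A2.RESCUE.J; table of record `HOME/plan/E/R-J/Y-CENSUS.tsv`, row Y-21 letter f), seat abc-iut-E-t31 (gen 3), whose
lineage typed the carrier: E-t31 `Joshi/ATS4LocusUpperBounds.lean` (p430311: `LocusVolumeDatum`, the READING PREDICATE
`LocusVolumeDatum.Eq6811`), E-t31 `Joshi/ATS4DescentToFirstMainBound.lean` (p433649: `MainBoundGlue`), E-t30
`Joshi/ATS4MainBoundsGenuine(Theta).lean` (p439256 / p440894: `MainBoundDatum.ofGenuine`, the genuine Legendre theta tower).
**No side is taken** on [IUTchIII] Cor. 3.12 / [IUTchIV] Thm. 1.10, on Joshi's claims (unrefereed arXiv preprint, «Preliminary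
version for comments») or on Mochizuki's report on them; typed ≠ proved ≠ endorsed; NOT an abc claim. DEFS-FREEZE respected:
every object file is imported BY NAME; nothing is restated; no `def`, no new `Prop`, no instance, no notation.

## The printed sentence and its typed form

[J-IV] (6.8.11) (p.64 l.2–3; render `HOME/lit/renders/Joshi-arxiv-2403.10430/p0064.txt`): «log(s_ℚ) ≤ 2·d_mod·(log(d_{L_tpd}) +
log(f_{L_tpd})) + log(2·3·5·ℓ)», argued p.63 l.6 – p.64 l.42 from [Serre 1979, III Prop. 13] and Thm. 4.6.1, with (6.8.12) (p.64
l.4–13) «log(s_ℚ) = Σ_{p ∈ V^dst_ℚ} 1·log(p)» and §6.6 (p.60 l.56–62) «v ∈ V^dst_M, if and only if, v extends to a prime of L′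
which is ramified over ℚ», Lemma 6.7.1 (p.61 l.20–27) «(1) v_ℚ ∈ V^dst_ℚ ⟺ (2) v_ℚ ramifies in L′ ⟺ (3) v_ℚ divides 30·ℓ or v_ℚ is in
the image of Supp(q_{L_tpd} + d_{L_tpd})». E-t31 typed it on the FREE real carrier as
`LocusVolumeDatum.Eq6811 : d.logsQ ≤ 2·d.dmod·(d.logDiffTpd + d.logCondTpd) + log(2·3·5·d.l)` ([IUTchIV] twin, verbatim: the INPUT
field `Literature.IUT.LogVolume.Thm110Numerics.ProofData.sQ_le` of Thm. 1.10 Step (iii), p.26).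

## What the kernel DERIVES here (inputs ⊆ tree theorems; FACT content = Dedekind's different theorem `e − 1 ≤ ord_w 𝔡`,
## multiplicativity of ramification indices, Galois conjugates ramify together — all PROVED in the tree's
## `Literature.IUT.LogVolume.DistinguishedPrimesBound(Galois|Tower).lean`, [IUTchIV] Step (iii) for REAL number fields)

1. `LocusVolumeDatum.eq6811_of_genuineTower` — for EVERY carrier `d` whose slots are read off a genuine tower of Mathlib number
   fields `L_mod ⊆ L_tpd ⊆ L′` with `L_tpd/L_mod` Galois: `d_mod := [L_mod:ℚ]`, `log(d_{L_tpd}) := ndeg(𝔡^{L_tpd})`, `log(f_{L_tpd}) :=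
   ndeg` of the reduced divisor on a set `S₀` of places of `L_tpd` which is the full preimage of a set `S` of places of `L_mod` (§4.1.1
   (2) «d_mod = [L_mod : ℚ]» with `L_mod ⊆ L_tpd` of the Initial Theta Data, [J-III] §3.1 — Mochizuki's `F_mod ⊆ F_tpd` of [IUTchI]
   Def. 3.1, `F_mod` the field of moduli, over which the bad places are defined), `log(s_ℚ) := Σ_{p ∈ V^dst} log p` ((6.8.12)) over any finite set `V^dst` of
   primes each dividing `2·3·5·ℓ` or lying under a place of `L′` RAMIFIED over `ℚ` (§6.6 / Lemma 6.7.1 (1)⟺(2) — this CONTAINS Joshi's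
   `V^dst_ℚ`), and the (D0)-type descent «a place of `L′` ramified over `ℚ` of residue characteristic `∤ 30ℓ` lies over a place of `L_tpd`
   that is in `S₀` or is itself ramified over `ℚ`» (Lemma 6.7.1 (2)⟹(3)): `d.Eq6811` HOLDS — the tree's
   `Literature.IUT.LogVolume.sum_log_distinguished_le_tower`.
2. `LocusVolumeDatum.eq6811_of_genuineTower_unramified` — the same with the descent DISCHARGED from the two printed
   unramifiedness clauses along `L_tpd ⊆ L ⊆ L′` («L′/L and L/L_tpd unramified at the good places ∤ 30ℓ», Thm. 4.6.1 / [IUTchIV] (D0);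
   tree `ramified_place_descends_of_not_dvd`).
3. `MainBoundGlue.eq6811_ofGenuine` — row Y-21f AT E-t30's GENUINE CARRIER: under `MainBoundGlue (MainBoundDatum.ofGenuine L_mod … 𝔮tpd 𝔮L 𝔮L′ …) d`
   (so `d_mod`, `log(d_{L_tpd}) = logDifferent L_tpd`, `log(f_{L_tpd}) = 𝔮tpd.logf` ARE the genuine numbers) with `L_mod ⊆ L_tpd` Galois
   and `Supp(𝔮_{L_tpd}) = 𝔮tpd.V` descending to `L_mod`, `d.Eq6811` holds for every `log(s_ℚ)`-slot instantiated by (6.8.12) over such a `V^dst`.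
4. `MainBoundGlue.eq6811_thetaTower` — THE INSTANCE AT JOSHI'S OWN DATA (Rmk. 6.1.2: `L_tpd/L/L′ ↦ F_tpd/F/K`), i.e. at the carrier of
   the E5 spine of record (E-t30 p443293 `abc_of_thetaTowerDescentInputs` / E-t35 p446138 `abc_of_thetaTowerIneq`): `L_tpd := ℚ(λ)`,
   `𝔮tpd := TateDivisorDatum.ofNFPoint λ {2,ℓ}`, `L := F` a theta field, `L′ := K` Galois over `F` inside the `ℓ`-division field of the
   Legendre curve. Here the (D0) descent is a THEOREM of the tree (`Cor22.ramificationIdx_divisionTower_tpd_eq_one`, abc-iut-S-d1), so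
   the ONLY inputs left are: `L_mod ⊆ ℚ(λ)` Galois with the `{2,ℓ}`-avoiding bad places of `λ` descending to `L_mod`, and the
   instantiation of the two free slots `V^dst`, `log(s_ℚ)` by §6.6 / (6.8.12).
5. `MainBoundGlue.eq6811_thetaTower_self` — NON-VACUITY of 4's side conditions: `L_mod := ℚ(λ)` itself (`d_mod = [ℚ(λ):ℚ]`, which the
   spine admits since `λ ∈ U(Q̄)_{≤ d}`) satisfies them, so at every λ-line point of the spine there IS an admissible `L_mod` at which
   Y-21f is a theorem.

LOCATED (numbers, not adjectives): the factor `2·d_mod` is EXACTLY what Galois-conjugate places ramifying together give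
(`half_finrank_mul_log_le_sum_fibre`: `≥ ([L_tpd:L_mod]/2)·log p` per distinguished `p ∤ 30ℓ`); E-t30's dictionary `ofGenuine L_mod …`
lets `L_mod` be ANY number field entering only through `(d_mod, e_mod)` — for an `L_mod` that is not a Galois subfield of `L_tpd` under
which the bad places descend, (6.8.11) is not supplied by this argument (and is false in general: one prime `p ∤ 30ℓ` ramified in
`L_tpd` with a single ramified place of `e = 2, f = 1` contributes `log p/[L_tpd:ℚ]` to `ndeg(𝔡^{L_tpd})`, not `log p/2`). So the census
reading of Y-21f is: DERIVED at genuine data for the printed `L_mod ⊆ L_tpd` (§4.1.1 (2) / [J-III] §3.1; [IUTchI] Def. 3.1's field of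
moduli) — in the spine, for every admissible choice `L_mod ⊆ ℚ(λ)` Galois under which the bad places descend (e.g. `ℚ(λ)` itself); the free-carrier form stays jointly (E)-bearing per E-t35 p446138 / E-t21.
[claim: Joshi2024ATS4, status: disputed] (locators only); the mathematics is [IUTchIV] Step (iii) for real number fields as PROVED
in the tree ([claim: Mochizuki2012, status: disputed] for its locators) — classical (Dedekind). Standard axioms only.
-/

noncomputable section

namespace Summit.ABC.IUTFork.Joshi.ATS4

open NumberField IsDedekindDomain Finset
open Literature.IUT.LogVolume Literature.IUT.LogVolume.Cor22
open Literature.NumberTheory.DiophantineGeometry Literature.NumberTheory.DiophantineGeometry.GenEll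
open Literature.NumberTheory.NumberFields (ramificationIdx_int_eq_mul)

/-! ## 1. (6.8.11) on any carrier read off a genuine tower `L_mod ⊆ L_tpd ⊆ L′` -/

namespace LocusVolumeDatum

variable (d : LocusVolumeDatum)

/-- **(6.8.11) DERIVED at genuine distinguished primes.** Let `L_mod ⊆ L_tpd ⊆ L′` be number fields with `L_tpd/L_mod` Galois, `S` a
finite set of places of `L_mod` and `S₀` the places of `L_tpd` over `S` (the bad places `Supp(𝔮_{L_tpd})`, descending to the field of
moduli: §4.1.1 (2) / [J-III] §3.1 / [IUTchI] Def. 3.1; Def. 4.4.2). If the carrier's slots read `d_mod = [L_mod:ℚ]`, `log(d_{L_tpd}) = ndeg(𝔡^{L_tpd})`, `log(f_{L_tpd}) =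
ndeg((Σ_{S₀} w)_red)`, `log(s_ℚ) = Σ_{p ∈ V^dst} log p` ((6.8.12), p.64 l.4–13) with `V^dst` a finite set of primes each dividing `2·3·5·ℓ`
or lying under a place of `L′` ramified over `ℚ` (§6.6 p.60 l.56–62 / Lemma 6.7.1 (1)⟺(2), p.61 l.20–23), and the (D0)-type descent
holds (a place of `L′` ramified over `ℚ` with residue characteristic `∤ 2·3·5·ℓ` lies over a place of `L_tpd` in `S₀` or ramified over
`ℚ` — Lemma 6.7.1 (2)⟹(3)), then `Eq6811 d` («log(s_ℚ) ≤ 2·d_mod·(log(d_{L_tpd}) + log(f_{L_tpd})) + log(2·3·5·ℓ)», p.64 l.2–3). PROVED: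
the tree's [IUTchIV] Step (iii) theorem for real number fields `sum_log_distinguished_le_tower` (Dedekind `e − 1 ≤ ord_w 𝔡`, Galois
conjugates ramify together). [claim: Joshi2024ATS4, status: disputed] -/
theorem eq6811_of_genuineTower
    (Lmod Ltpd L' : Type*) [Field Lmod] [NumberField Lmod] [Field Ltpd] [NumberField Ltpd] [Field L'] [NumberField L']
    [Algebra Lmod Ltpd] [IsGalois Lmod Ltpd] [Algebra Ltpd L']
    (S : Finset (HeightOneSpectrum (𝓞 Lmod))) (S₀ : Finset (HeightOneSpectrum (𝓞 Ltpd)))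
    (hS₀ : ∀ w₀, w₀ ∈ S₀ ↔ finBelow Lmod Ltpd w₀ ∈ S)
    (hdmod : d.dmod = Module.finrank ℚ Lmod)
    (hdiff : d.logDiffTpd = ndeg Ltpd (differentDivisor Ltpd))
    (hcond : d.logCondTpd = ndeg Ltpd (ADivisor.reduced S₀))
    (hsQ : d.logsQ = ∑ q ∈ d.Vdst, Real.log q)
    (hprime : ∀ q ∈ d.Vdst, q.Prime)
    (hdst : ∀ q ∈ d.Vdst, q ∣ 2 * 3 * 5 * d.l ∨
      ∃ u : HeightOneSpectrum (𝓞 L'), residueChar L' u = q ∧ 2 ≤ u.asIdeal.ramificationIdx ℤ)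
    (hD0 : ∀ u : HeightOneSpectrum (𝓞 L'), 2 ≤ u.asIdeal.ramificationIdx ℤ → ¬ residueChar L' u ∣ 2 * 3 * 5 * d.l →
      finBelow Ltpd L' u ∈ S₀ ∨ 2 ≤ (finBelow Ltpd L' u).asIdeal.ramificationIdx ℤ) :
    d.Eq6811 := by
  unfold Eq6811
  have hl : 0 < d.l := by have := d.five_le_l; omega
  have h := sum_log_distinguished_le_tower Ltpd L' Lmod S S₀ hS₀ hl d.Vdst hprime hdst hD0
  rw [hsQ, hdmod, hdiff, hcond]
  exact_mod_cast h

/-- **(6.8.11) DERIVED with the descent discharged from the two unramifiedness clauses** along `L_tpd ⊆ L ⊆ L′`: «L′/L is unramified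
at the places of residue characteristic `∉ {2,3,5,ℓ}` not over `S₀`» and «L/L_tpd likewise» (the (D0) sentence of Lemma 6.6.1's
proof, p.61 l.4–12: «if v_M extends to some prime v of L′ which is ramified then v|d_M or v|q_M or v|2·3·5·ℓ»; Thm. 4.6.1). PROVED via
the tree's `ramified_place_descends_of_not_dvd`. [claim: Joshi2024ATS4, status: disputed] -/
theorem eq6811_of_genuineTower_unramified
    (Lmod Ltpd L L' : Type*) [Field Lmod] [NumberField Lmod] [Field Ltpd] [NumberField Ltpd] [Field L] [NumberField L]
    [Field L'] [NumberField L'] [Algebra Lmod Ltpd] [IsGalois Lmod Ltpd] [Algebra Ltpd L] [Algebra L L'] [Algebra Ltpd L']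
    [IsScalarTower Ltpd L L']
    (S : Finset (HeightOneSpectrum (𝓞 Lmod))) (S₀ : Finset (HeightOneSpectrum (𝓞 Ltpd)))
    (hS₀ : ∀ w₀, w₀ ∈ S₀ ↔ finBelow Lmod Ltpd w₀ ∈ S)
    (hdmod : d.dmod = Module.finrank ℚ Lmod)
    (hdiff : d.logDiffTpd = ndeg Ltpd (differentDivisor Ltpd))
    (hcond : d.logCondTpd = ndeg Ltpd (ADivisor.reduced S₀))
    (hsQ : d.logsQ = ∑ q ∈ d.Vdst, Real.log q)
    (hprime : ∀ q ∈ d.Vdst, q.Prime)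
    (hdst : ∀ q ∈ d.Vdst, q ∣ 2 * 3 * 5 * d.l ∨
      ∃ u : HeightOneSpectrum (𝓞 L'), residueChar L' u = q ∧ 2 ≤ u.asIdeal.ramificationIdx ℤ)
    (hKunr : ∀ u : HeightOneSpectrum (𝓞 L'), residueChar L' u ∉ ({2, 3, 5, d.l} : Finset ℕ) →
      finBelow Ltpd L' u ∉ S₀ → u.asIdeal.ramificationIdx (𝓞 L) = 1)
    (hFunr : ∀ w : HeightOneSpectrum (𝓞 L), residueChar L w ∉ ({2, 3, 5, d.l} : Finset ℕ) →
      finBelow Ltpd L w ∉ S₀ → w.asIdeal.ramificationIdx (𝓞 Ltpd) = 1) :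
    d.Eq6811 :=
  d.eq6811_of_genuineTower Lmod Ltpd L' S S₀ hS₀ hdmod hdiff hcond hsQ hprime hdst
    (fun u hram hp => ramified_place_descends_of_not_dvd Ltpd L L' S₀ hKunr hFunr u hram hp)

end LocusVolumeDatum

/-! ## 2. Row Y-21f at E-t30's genuine carrier `MainBoundDatum.ofGenuine` -/

namespace MainBoundGlue

section Genuine

variable (Lmod : Type*) [Field Lmod] [NumberField Lmod]
variable {Ltpd L L' : Type*} [Field Ltpd] [NumberField Ltpd] [Field L] [NumberField L] [Field L'] [NumberField L']
  [Algebra Ltpd L] [Algebra L L']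
variable {ℓ : ℕ} (hℓ : ℓ.Prime) (h5 : 5 ≤ ℓ)
variable (𝔮tpd : TateDivisorDatum Ltpd) (𝔮L : TateDivisorDatum L) (𝔮L' : TateDivisorDatum L') (hq : 0 < 𝔮L.logq)

/-- **Y-21f at the genuine carrier.** Under E-t31's glue to E-t30's genuine Thm-6.1.1 datum `ofGenuine L_mod … 𝔮tpd 𝔮L 𝔮L′ …` (so
`d_mod = [L_mod:ℚ]`, `log(d_{L_tpd}) = logDifferent L_tpd`, `log(f_{L_tpd}) = log(𝔣_{L_tpd})` of Def. 4.4.2 ARE the carrier's numbers),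
with `L_mod ⊆ L_tpd` Galois and `Supp(𝔮_{L_tpd}) = 𝔮tpd.V` the set of places over a set `S` of places of `L_mod` (§4.1.1 (2) /
[J-III] §3.1), any
instantiation of the free slots by §6.6 / (6.8.12) — `V^dst ⊆ {p : p ∣ 30ℓ ∨ p under a place of L′ ramified over ℚ}`, `log(s_ℚ) =
Σ_{V^dst} log p` — satisfies (6.8.11), given the (D0) descent for `L_tpd ⊆ L′`. PROVED. [claim: Joshi2024ATS4, status: disputed] -/
theorem eq6811_ofGenuine [Algebra Lmod Ltpd] [IsGalois Lmod Ltpd] [Algebra Ltpd L']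
    (S : Finset (HeightOneSpectrum (𝓞 Lmod))) (hS : ∀ w₀, w₀ ∈ 𝔮tpd.V ↔ finBelow Lmod Ltpd w₀ ∈ S)
    {d : LocusVolumeDatum} (G : MainBoundGlue (MainBoundDatum.ofGenuine Lmod hℓ h5 𝔮tpd 𝔮L 𝔮L' hq) d)
    (hsQ : d.logsQ = ∑ q ∈ d.Vdst, Real.log q) (hprime : ∀ q ∈ d.Vdst, q.Prime)
    (hdst : ∀ q ∈ d.Vdst, q ∣ 2 * 3 * 5 * ℓ ∨
      ∃ u : HeightOneSpectrum (𝓞 L'), residueChar L' u = q ∧ 2 ≤ u.asIdeal.ramificationIdx ℤ)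
    (hD0 : ∀ u : HeightOneSpectrum (𝓞 L'), 2 ≤ u.asIdeal.ramificationIdx ℤ → ¬ residueChar L' u ∣ 2 * 3 * 5 * ℓ →
      finBelow Ltpd L' u ∈ 𝔮tpd.V ∨ 2 ≤ (finBelow Ltpd L' u).asIdeal.ramificationIdx ℤ) :
    d.Eq6811 := by
  have hl : d.l = ℓ := G.l_eq
  refine d.eq6811_of_genuineTower Lmod Ltpd L' S 𝔮tpd.V hS G.dmod_eq G.logDiffTpd_eq G.logCondTpd_eq hsQ hprime ?_ ?_
  · rw [hl]; exact hdst
  · rw [hl]; exact hD0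

end Genuine

/-! ## 3. The instance at Joshi's own data: the genuine Legendre theta tower `ℚ(λ) ⊆ F ⊆ K` (Rmk. 6.1.2) -/

section Theta

variable (Lmod : Type*) [Field Lmod] [NumberField Lmod]
variable {P : NFPoint} {F : Type} [Field F] [NumberField F] [Algebra P.F F]
  {K : Type} [Field K] [NumberField K] [Algebra F K] [Algebra P.F K] [IsScalarTower P.F F K]
variable {ℓ : ℕ} (hℓ : ℓ.Prime) (h5 : 5 ≤ ℓ) (hq : 0 < (TateDivisorDatum.ofNFPointOver P {2, ℓ} F).logq)

/-- **(D0) ⟹ the descent hypothesis, PROVED on the genuine theta tower** `ℚ(λ) ⊆ F ⊆ K` (`F` a theta field of `λ ∈ U`, `K ⊇ F` Galois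
inside the `ℓ`-division field of the Legendre curve): a place `u` of `K` ramified over `ℚ` with residue characteristic `∤ 2·3·5·ℓ` lies
over a place of `ℚ(λ)` which is a `{2,ℓ}`-avoiding bad place of `λ` (`∈ (ofNFPoint λ {2,ℓ}).V = Supp(𝔮_{F_tpd})`) or is itself ramified
over `ℚ` — by the tree's `Cor22.ramificationIdx_divisionTower_tpd_eq_one` (abc-iut-S-d1: `K/F_tpd` unramified at the good places
`∤ 30ℓ`) and `e(u|p) = e(v|p)·e(u|v)`. [claim: Joshi2024ATS4, status: disputed] -/
theorem thetaTower_descent (hℓ : ℓ.Prime) [IsGalois F K] (ψ : K →ₐ[F] AlgebraicClosure F) (hU : P.InU) (hF : IsThetaField P F)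
    (hK : letI := thetaCurve_isElliptic hU F
      ((thetaCurve P F).galoisRepTorsion (ℓ : ℤ)).ker ≤ ψ.fieldRange.fixingSubgroup)
    (u : HeightOneSpectrum (𝓞 K)) (hram : 2 ≤ u.asIdeal.ramificationIdx ℤ)
    (hp : ¬ residueChar K u ∣ 2 * 3 * 5 * ℓ) :
    finBelow P.F K u ∈ (TateDivisorDatum.ofNFPoint P {2, ℓ}).V ∨
      2 ≤ (finBelow P.F K u).asIdeal.ramificationIdx ℤ := by
  -- residue-characteristic bookkeeping: `p_u ∉ {2, 3, 5, ℓ}`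
  have hne : ∀ {m : ℕ}, m ∣ 2 * 3 * 5 * ℓ → residueChar K u ≠ m := by
    intro m hm h; exact hp (h ▸ hm)
  have h2 : residueChar K u ≠ 2 := hne ⟨3 * 5 * ℓ, by ring⟩
  have h3 : residueChar K u ≠ 3 := hne ⟨2 * 5 * ℓ, by ring⟩
  have h5' : residueChar K u ≠ 5 := hne ⟨2 * 3 * ℓ, by ring⟩
  have hl' : residueChar K u ≠ ℓ := hne ⟨2 * 3 * 5, by ring⟩
  have h30 : ((30 : ℕ) : 𝓞 P.F) ∉ (finBelow P.F K u).asIdeal := by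
    refine thirty_notMem_finBelow_of_residueChar_notMem u ?_
    simp only [Finset.mem_insert, Finset.mem_singleton, not_or]
    exact ⟨h2, h3, h5'⟩
  have hlu : ((ℓ : ℕ) : 𝓞 P.F) ∉ (finBelow P.F K u).asIdeal :=
    natCast_notMem_finBelow_of_residueChar_ne hℓ u hl'
  have h2u : ((2 : ℕ) : 𝓞 P.F) ∉ (finBelow P.F K u).asIdeal :=
    natCast_notMem_finBelow_of_residueChar_ne Nat.prime_two u h2
  by_cases hbad : finBelow P.F K u ∈ badPlaces P
  · refine Or.inl ?_
    rw [TateDivisorDatum.mem_ofNFPoint_V]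
    refine ⟨hbad, fun p hp' => ?_⟩
    simp only [Finset.mem_insert, Finset.mem_singleton] at hp'
    rcases hp' with rfl | rfl
    · exact h2u
    · exact hlu
  · refine Or.inr ?_
    have h1 : u.asIdeal.ramificationIdx (𝓞 P.F) = 1 :=
      ramificationIdx_divisionTower_tpd_eq_one F hU hF ψ hK u h30 hlu hbad
    have hmul := ramificationIdx_int_eq_mul P.F K u.asIdeal
    rw [h1, mul_one] at hmul
    change u.asIdeal.ramificationIdx ℤ = (finBelow P.F K u).asIdeal.ramificationIdx ℤ at hmul
    rw [← hmul]
    exact hram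

/-- **Y-21f AT JOSHI'S OWN DATA (Rmk. 6.1.2 `L_tpd/L/L′ ↦ F_tpd/F/K`): (6.8.11) holds at the genuine theta-tower carrier of the E5 spine**
(E-t30 `MainBoundDatum.ofGenuine L_mod … (ofNFPoint λ {2,ℓ}) (ofNFPointOver λ {2,ℓ} F) (ofNFPointOver λ {2,ℓ} K)`, as in p443293 /
p446138) for every glued E-t31 carrier whose two free slots are instantiated by §6.6 / (6.8.12) — `V^dst ⊆ {p : p ∣ 30ℓ ∨ p under a
place of K ramified over ℚ}`, `log(s_ℚ) = Σ_{V^dst} log p` — PROVIDED `L_mod ⊆ ℚ(λ)` is Galois with the `{2,ℓ}`-avoiding bad places of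
`λ` descending to `L_mod` (§4.1.1 (2) / [J-III] §3.1: the `L_mod ⊆ L_tpd` of the Initial Theta Data — [IUTchI] Def. 3.1's field of
moduli `F_mod`). The (D0) descent is DISCHARGED (`thetaTower_descent`); no
FACT-list row beyond the tree's PROVED classical theorems is used. [claim: Joshi2024ATS4, status: disputed] -/
theorem eq6811_thetaTower [Algebra Lmod P.F] [IsGalois Lmod P.F] [IsGalois F K] (ψ : K →ₐ[F] AlgebraicClosure F)
    (hU : P.InU) (hF : IsThetaField P F)
    (hK : letI := thetaCurve_isElliptic hU F
      ((thetaCurve P F).galoisRepTorsion (ℓ : ℤ)).ker ≤ ψ.fieldRange.fixingSubgroup)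
    (S : Finset (HeightOneSpectrum (𝓞 Lmod)))
    (hS : ∀ w₀, w₀ ∈ (TateDivisorDatum.ofNFPoint P {2, ℓ}).V ↔ finBelow Lmod P.F w₀ ∈ S)
    {d : LocusVolumeDatum}
    (G : MainBoundGlue (MainBoundDatum.ofGenuine Lmod hℓ h5 (TateDivisorDatum.ofNFPoint P {2, ℓ})
      (TateDivisorDatum.ofNFPointOver P {2, ℓ} F) (TateDivisorDatum.ofNFPointOver P {2, ℓ} K) hq) d)
    (hsQ : d.logsQ = ∑ q ∈ d.Vdst, Real.log q) (hprime : ∀ q ∈ d.Vdst, q.Prime)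
    (hdst : ∀ q ∈ d.Vdst, q ∣ 2 * 3 * 5 * ℓ ∨
      ∃ u : HeightOneSpectrum (𝓞 K), residueChar K u = q ∧ 2 ≤ u.asIdeal.ramificationIdx ℤ) :
    d.Eq6811 :=
  eq6811_ofGenuine Lmod hℓ h5 _ _ _ hq S hS G hsQ hprime hdst
    (fun u hram hp => thetaTower_descent hℓ ψ hU hF hK u hram hp)

/-- `finBelow` along the identity is the identity. [folklore] -/
theorem finBelow_self {M : Type*} [Field M] [NumberField M] (w : HeightOneSpectrum (𝓞 M)) : finBelow M M w = w := by
  apply HeightOneSpectrum.ext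
  change Ideal.comap (algebraMap (𝓞 M) (𝓞 M)) w.asIdeal = w.asIdeal
  ext x
  rw [Ideal.mem_comap]
  have hx : algebraMap (𝓞 M) (𝓞 M) x = x := Subtype.ext rfl
  rw [hx]

/-- **NON-VACUITY of the side conditions of `eq6811_thetaTower`: `L_mod := ℚ(λ)` itself is admissible** (Galois over itself; the bad
places descend to themselves; `d_mod = [ℚ(λ):ℚ] ≤ d` for `λ ∈ U(Q̄)_{≤ d}`, the spine's `dMod L_mod ≤ d`). So at EVERY λ-line point of
the E5 spine there is an admissible `L_mod` at which Y-21f is a theorem for every §6.6 / (6.8.12) instantiation of the free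
slots. PROVED. [claim: Joshi2024ATS4, status: disputed] -/
theorem eq6811_thetaTower_self [IsGalois F K] (ψ : K →ₐ[F] AlgebraicClosure F) (hU : P.InU) (hF : IsThetaField P F)
    (hK : letI := thetaCurve_isElliptic hU F
      ((thetaCurve P F).galoisRepTorsion (ℓ : ℤ)).ker ≤ ψ.fieldRange.fixingSubgroup)
    {d : LocusVolumeDatum}
    (G : MainBoundGlue (MainBoundDatum.ofGenuine P.F hℓ h5 (TateDivisorDatum.ofNFPoint P {2, ℓ})
      (TateDivisorDatum.ofNFPointOver P {2, ℓ} F) (TateDivisorDatum.ofNFPointOver P {2, ℓ} K) hq) d)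
    (hsQ : d.logsQ = ∑ q ∈ d.Vdst, Real.log q) (hprime : ∀ q ∈ d.Vdst, q.Prime)
    (hdst : ∀ q ∈ d.Vdst, q ∣ 2 * 3 * 5 * ℓ ∨
      ∃ u : HeightOneSpectrum (𝓞 K), residueChar K u = q ∧ 2 ≤ u.asIdeal.ramificationIdx ℤ) :
    d.Eq6811 :=
  eq6811_thetaTower P.F hℓ h5 hq ψ hU hF hK (TateDivisorDatum.ofNFPoint P {2, ℓ}).V
    (fun w₀ => by rw [finBelow_self]) G hsQ hprime hdst

end Theta

/-! ## 4. (gen 3, second pass) The `V^dst` slot made GENUINE too: `V^dst := primeFactors(2·3·5·ℓ) ∪ primeFactors(|disc L′|)`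

Lemma 6.7.1 (p.61 l.20–27): «(1) v_ℚ ∈ V^dst_ℚ ⟺ (2) v_ℚ ramifies in L′ ⟺ (3) v_ℚ divides 30·ℓ or …» — on Mathlib number fields «v_ℚ
ramifies in L′» is «p ∣ disc(L′)» (Dedekind's discriminant theorem, Mathlib `NumberField.not_dvd_discr_iff_isUnramifiedIn`; the direction used
here, `p ∣ disc ⟹ ∃` a place of `L′` over `p` with `e ≥ 2`, is the tree's `exists_two_le_ramificationIdx_of_dvd_discr`), and by (1)⟺(3) every
prime of `30ℓ` is distinguished. So the finite set of rational primes `primeFactors(2·3·5·ℓ) ∪ primeFactors(|disc L′|)` IS a genuine reading of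
Joshi's `V^dst_ℚ` (the «∪ primeFactors(30ℓ)» part is contained in it by (3)⟹(1); the discriminant part is (2)), and with `log(s_ℚ) := Σ` over
it ((6.8.12)) NO abstract condition on the carrier's `V^dst` / `log(s_ℚ)` slots remains. -/

section ThetaDiscr

variable (Lmod : Type*) [Field Lmod] [NumberField Lmod]
variable {P : NFPoint} {F : Type} [Field F] [NumberField F] [Algebra P.F F]
  {K : Type} [Field K] [NumberField K] [Algebra F K] [Algebra P.F K] [IsScalarTower P.F F K]
variable {ℓ : ℕ} (hℓ : ℓ.Prime) (h5 : 5 ≤ ℓ) (hq : 0 < (TateDivisorDatum.ofNFPointOver P {2, ℓ} F).logq)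

/-- The primes of `primeFactors(2·3·5·ℓ) ∪ primeFactors(|disc K|)` are primes, and each divides `2·3·5·ℓ` or lies under a place of `K`
ramified over `ℚ` (Dedekind: `p ∣ disc K ⟹ ∃ u ∣ p, e(u|p) ≥ 2`, tree `exists_two_le_ramificationIdx_of_dvd_discr`). [folklore] -/
theorem vdst_discr_spec (K : Type) [Field K] [NumberField K] (ℓ : ℕ) {q : ℕ}
    (hq : q ∈ (2 * 3 * 5 * ℓ).primeFactors ∪ (NumberField.discr K).natAbs.primeFactors) :
    q.Prime ∧ (q ∣ 2 * 3 * 5 * ℓ ∨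
      ∃ u : HeightOneSpectrum (𝓞 K), residueChar K u = q ∧ 2 ≤ u.asIdeal.ramificationIdx ℤ) := by
  rcases Finset.mem_union.mp hq with h | h
  · exact ⟨Nat.prime_of_mem_primeFactors h, Or.inl (Nat.dvd_of_mem_primeFactors h)⟩
  · have hqp := Nat.prime_of_mem_primeFactors h
    exact ⟨hqp, Or.inr (exists_two_le_ramificationIdx_of_dvd_discr K hqp (Int.natCast_dvd.mpr (Nat.dvd_of_mem_primeFactors h)))⟩

/-- **Y-21f AT JOSHI'S OWN DATA WITH THE GENUINE `V^dst`**: at the theta-tower carrier (as in `eq6811_thetaTower`), if the carrier's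
`V^dst` slot IS `primeFactors(2·3·5·ℓ) ∪ primeFactors(|disc K|)` (Lemma 6.7.1 (1)⟺(2)⟺(3) read through Dedekind's discriminant theorem, `K`
= Joshi's `L′`) and `log(s_ℚ) = Σ_{V^dst} log p` ((6.8.12)), then (6.8.11) `Eq6811` holds — for every admissible `L_mod ⊆ ℚ(λ)` (§4.1.2 (8),
p.38 l.8: `L_mod ⊆ L_tpd` Galois, bad places descending). Only genuine objects and the glue remain in the hypotheses. PROVED.
[claim: Joshi2024ATS4, status: disputed] -/
theorem eq6811_thetaTower_discr [Algebra Lmod P.F] [IsGalois Lmod P.F] [IsGalois F K] (ψ : K →ₐ[F] AlgebraicClosure F)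
    (hU : P.InU) (hF : IsThetaField P F)
    (hK : letI := thetaCurve_isElliptic hU F
      ((thetaCurve P F).galoisRepTorsion (ℓ : ℤ)).ker ≤ ψ.fieldRange.fixingSubgroup)
    (S : Finset (HeightOneSpectrum (𝓞 Lmod)))
    (hS : ∀ w₀, w₀ ∈ (TateDivisorDatum.ofNFPoint P {2, ℓ}).V ↔ finBelow Lmod P.F w₀ ∈ S)
    {d : LocusVolumeDatum}
    (G : MainBoundGlue (MainBoundDatum.ofGenuine Lmod hℓ h5 (TateDivisorDatum.ofNFPoint P {2, ℓ})
      (TateDivisorDatum.ofNFPointOver P {2, ℓ} F) (TateDivisorDatum.ofNFPointOver P {2, ℓ} K) hq) d)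
    (hV : d.Vdst = (2 * 3 * 5 * ℓ).primeFactors ∪ (NumberField.discr K).natAbs.primeFactors)
    (hsQ : d.logsQ = ∑ q ∈ d.Vdst, Real.log q) : d.Eq6811 :=
  eq6811_thetaTower Lmod hℓ h5 hq ψ hU hF hK S hS G hsQ (fun _ hq' => (vdst_discr_spec K ℓ (hV ▸ hq')).1)
    (fun _ hq' => (vdst_discr_spec K ℓ (hV ▸ hq')).2)

/-- **The fully genuine non-vacuous instance**: `L_mod := ℚ(λ)`, `V^dst := primeFactors(2·3·5·ℓ) ∪ primeFactors(|disc K|)`, `log(s_ℚ) := Σ_{V^dst}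
log p` — (6.8.11) holds at the theta-tower carrier of every λ-line point of the E5 spine. PROVED. [claim: Joshi2024ATS4, status: disputed] -/
theorem eq6811_thetaTower_discr_self [IsGalois F K] (ψ : K →ₐ[F] AlgebraicClosure F) (hU : P.InU) (hF : IsThetaField P F)
    (hK : letI := thetaCurve_isElliptic hU F
      ((thetaCurve P F).galoisRepTorsion (ℓ : ℤ)).ker ≤ ψ.fieldRange.fixingSubgroup)
    {d : LocusVolumeDatum}
    (G : MainBoundGlue (MainBoundDatum.ofGenuine P.F hℓ h5 (TateDivisorDatum.ofNFPoint P {2, ℓ})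
      (TateDivisorDatum.ofNFPointOver P {2, ℓ} F) (TateDivisorDatum.ofNFPointOver P {2, ℓ} K) hq) d)
    (hV : d.Vdst = (2 * 3 * 5 * ℓ).primeFactors ∪ (NumberField.discr K).natAbs.primeFactors)
    (hsQ : d.logsQ = ∑ q ∈ d.Vdst, Real.log q) : d.Eq6811 :=
  eq6811_thetaTower_discr P.F hℓ h5 hq ψ hU hF hK (TateDivisorDatum.ofNFPoint P {2, ℓ}).V
    (fun w₀ => by rw [finBelow_self]) G hV hsQ

end ThetaDiscr

end MainBoundGlue

end Summit.ABC.IUTFork.Joshi.ATS4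

end
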